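import Summits.NavierStokesRegularity.NavierStokesRegularity.Theorems.AxisymmetricExtremalityAxisymmetricKatoGlobalNoSwirlStratum
import Summits.NavierStokesRegularity.NavierStokesRegularity.Theorems.AxisymmetricExtremalityAxisymmetricKatoGlobalSwirlAxisModulusBelow
import HarnessLib

/-!
# Strategist census s12-g10 — crux `AxisymmetricExtremality.AxisymmetricKatoGlobal` (stmt-NavierStokesRegularity-15453)

Typed exhibits of the independent STRATEGY CENSUS (family `-s`, gen 10) for the crux
`AxisymmetricKatoGlobal` (AKG) of route `AxisymmetricExtremality`.  Every `theorem` below is proved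
(no `sorry`); every `def … : Prop` is an exhibit statement discussed in `STRATEGY-CENSUS-s12-g10.md`.

* §0 `SwirlAxisModulus` (= registered stub 3, verbatim) and `akg_of_swirlAxisModulus` — with
  Seregin's 2022 criterion DISCHARGED in the tree (`seregin2022_logSwirl_regularAtOrigin_holds`) the
  crux is now unconditionally implied by the single a-priori axis modulus.
* §1 WEAKEN FROM THE SUMMIT.  (a) `NoAxisymMinimalDatum` — the threshold instance that `closes`
  actually consumes, with the re-glue `closes_of_noAxisymMinimalDatum` (proved) and
  `noAxisymMinimalDatum_of_akg` (proved).  (b) THE DIHEDRAL BYPASS: `MinimalDatumDihedral` (the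
  route's Smith-theory crux asked for the dyadic DIHEDRAL 2-groups `D_{2^k}` instead of `Z_p`) and
  `DihedralToReflAxisym` (the analogue of the PROVED `PFoldToAxisymmetric`) close the summit WITHOUT
  AKG: `no_reflAxisym_minimalDatum` (an axisymmetric minimal blow-up datum equivariant under the
  meridian reflection is swirl-free, hence global by the PROVED no-swirl stratum — contradiction) and
  `closes_dihedral : MinimalDatumDihedral → DihedralToReflAxisym → NavierStokesRegularity` (proved).
* §2 DECOMPOSITION.  `SwirlEvacuatesAxis` (A: rate-free smallness of `Γ` at the axis up to the
  final time) and `SmallSwirlBoundedNearTop` (B: an ABSOLUTE ε-small-swirl regularity criterion at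
  axis points, no rate), with the proved assembly `akg_of_evacuation_smallSwirl : A → B → AKG` and
  the proved comparison `swirlEvacuatesAxis_of_swirlAxisModulus : stub 3 → A` (A is weaker than the
  registered stub).
* §3 STRENGTHEN.  `SwirlModulusPropagates` (S⁺: the log³ modulus propagates from one time to the
  final time with a doubled constant and the same radius) with `swirlAxisModulus_of_propagates :
  S⁺ → stub 3` (proved, via the trivial half `swirlAxisModulus_of_lt`).
* §4 TRANSFER.  `CriticalDriftNearAxis` — the first non-transferring step of the Type-I sibling
  (KNSS 2009 Thm 5.3 / Seregin–Šverák 2009): the critical drift bound `|u| ≤ Cν/r` near the axis up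
  to the final time, typed as the a-priori statement it would have to become under Type II.
-/

noncomputable section

open Set MeasureTheory Filter Topology Function Metric
open scoped ENNReal NNReal
open Literature.Analysis.FluidPDE

-- `<Problem> = <Summit>` duplicates a namespace component by design.
set_option linter.dupNamespace false

namespace Summit.NavierStokesRegularity.NavierStokesRegularity.Cruxes.AxisymmetricKatoGlobal.StrategistS12g10

open Summit.NavierStokesRegularity.NavierStokesRegularity.Theses.AxisymmetricExtremality
open Summit.NavierStokesRegularity.NavierStokesRegularity.Theorems.AxisymmetricKatoGlobal.Registered
open Summit.NavierStokesRegularity.NavierStokesRegularity.Theorems.AxisymmetricKatoGlobal.NoSwirlStratum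
open Summit.NavierStokesRegularity.NavierStokesRegularity.Theorems.AxisymmetricKatoGlobal.EulerScaling

/-- `ℝ³` as a Euclidean space. -/
abbrev E3 : Type := EuclideanSpace ℝ (Fin 3)

/-- The homogeneous Sobolev class `Ḣ^{1/2}(ℝ³; ℂ³)` of the crux. -/
abbrev Hhalf : Type :=
  Literature.Analysis.FunctionSpaces.HomSobolev (EuclideanSpace ℝ (Fin 3)) (EuclideanSpace ℂ (Fin 3)) (1 / 2 : ℝ)

/-! ## §0  The crux is (now unconditionally) the a-priori axis modulus of the swirl -/

/-- Registered stub 3 `stub_swirlAxisModulus`, verbatim: the logarithmic axis modulus of the swirl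
`Γ = r u_θ` up to the final time of an axisymmetric Kato solution from `Ḣ^{1/2}`-represented data. -/
def SwirlAxisModulus : Prop :=
  ∀ ν : ℝ, 0 < ν → ∀ T : ℝ, 0 < T → ∀ (u₀ : E3 → E3) (g : Hhalf) (u : ℝ → E3 → E3),
    g.Represents (Literature.Analysis.FunctionSpaces.EuclideanSpace.complexify ∘ u₀) →
    IsKatoSolutionOn T ν u₀ u → ContDiffOn ℝ (⊤ : ℕ∞) (uncurry u) (Ioo 0 T ×ˢ univ) →
    (∀ t ∈ Ioo 0 T, IsAxisymmetric (u t)) →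
    ∀ t₀ ∈ Ioo 0 T, ∃ C δ₀ : ℝ, 0 < δ₀ ∧ δ₀ < 1 ∧
      ∀ t ∈ Ico t₀ T, ∀ x : E3, cylRadius x ≤ δ₀ →
        |swirl (u t) x| ≤ C / |Real.log (cylRadius x)| ^ 3

/-- **Stub 3 ⇒ crux, unconditionally** (capstone `AxisymmetricKatoGlobal_of_logSwirlFacts` + the
discharged criterion `seregin2022_logSwirl_regularAtOrigin_holds`). -/
theorem akg_of_swirlAxisModulus (h : SwirlAxisModulus) : AxisymmetricKatoGlobal :=
  AxisymmetricKatoGlobal_of_logSwirlFacts seregin2022_logSwirl_regularAtOrigin_holds h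

/-! ## §1  Weaken from the summit -/

/-- (W0) The threshold instance consumed by `closes`: no axisymmetric `Ḣ^{1/2}`-minimal blow-up
datum (Rusin–Šverák threshold `ρ_max`). -/
def NoAxisymMinimalDatum : Prop :=
  ∀ ν : ℝ, 0 < ν → ∀ (u₀ : E3 → E3) (g : Hhalf), IsMinimalBlowupDatum ν u₀ g → IsAxisymmetric u₀ → False

/-- AKG ⇒ W0 (W0 is formally weaker). -/
theorem noAxisymMinimalDatum_of_akg (h : AxisymmetricKatoGlobal) : NoAxisymMinimalDatum := by
  intro ν hν u₀ g hmin hax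
  obtain ⟨hL3, hrep, hdiv, -, hnot⟩ := hmin
  exact hnot (h ν hν u₀ g hL3 hrep hdiv (fun θ x => hax θ x))

/-- Re-glue: W0 replaces AKG in the route's deciding theorem. -/
theorem closes_of_noAxisymMinimalDatum (h₂ : MinimalDatumPFold) (h₄ : PFoldToAxisymmetric)
    (h₀ : NoAxisymMinimalDatum) : _root_.NavierStokesRegularity := by
  show Literature.NS.NavierStokesExistenceSmoothR3
  intro ν hν u₀ hsm hdiv hdec
  by_contra hno
  obtain ⟨u₁, g, hmin, hax⟩ := h₄ ν hν (h₂ ν hν ⟨u₀, hsm, hdiv, hdec, hno⟩)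
  exact h₀ ν hν u₁ g hmin (fun θ x => hax θ x)

/-- Clay (A) fails at viscosity `ν`: some smooth, divergence-free, rapidly decaying datum has no
jointly smooth bounded-energy global solution (the hypothesis block of `MinimalDatumPFold`). -/
def ClayFailsAt (ν : ℝ) : Prop :=
  ∃ v₀ : E3 → E3, ContDiff ℝ (⊤ : ℕ∞) v₀ ∧ NSWave0.IsDivFree v₀ ∧ HasRapidSpatialDecay v₀ ∧
    ¬ ∃ (u : ℝ → E3 → E3) (p : ℝ → E3 → ℝ), IsSmoothOnHalfSpace u ∧ IsSmoothOnHalfSpace p ∧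
      IsNavierStokesSolution ν 0 v₀ u p ∧ HasBoundedEnergy u

/-- Dyadic dihedral symmetry `D_{2^k}` about the `x₂`-axis: equivariance under the rotation by
`2π/2^k` AND under the meridian reflection `σ(x₀,x₁,x₂) = (x₀,−x₁,x₂)` (`reflY`). -/
def IsDyadicDihedralSymmetric (k : ℕ) (u₀ : E3 → E3) : Prop :=
  (∀ x : E3, u₀ (rotZ (2 * Real.pi / (2 ^ k : ℕ)) x) = rotZ (2 * Real.pi / (2 ^ k : ℕ)) (u₀ x)) ∧
    (∀ x : E3, u₀ (reflY x) = reflY (u₀ x))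

/-- (W-dihedral, piece 1) The route's Smith-theory crux asked for DIHEDRAL 2-groups: if Clay (A)
fails at `ν`, then for every `N` there are `k ≥ N` and a minimal blow-up datum which is
`D_{2^k}`-symmetric.  Same mechanism and same bet as `MinimalDatumPFold` (P. A. Smith: a finite
`p`-group acting on a finite-dimensional `F_p`-acyclic compactum has a fixed point — `D_{2^k}` is a
2-group, so only `F_2`-acyclicity of `M̂ = M/Sim` is wanted, versus `F_p` for infinitely many `p`). -/
def MinimalDatumDihedral : Prop :=
  ∀ ν : ℝ, 0 < ν → ClayFailsAt ν → ∀ N : ℕ, ∃ k : ℕ, N ≤ k ∧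
    ∃ (u₀ : E3 → E3) (g : Hhalf), IsMinimalBlowupDatum ν u₀ g ∧ IsDyadicDihedralSymmetric k u₀

/-- (W-dihedral, piece 2) Compactness upgrade, the analogue of the PROVED `PFoldToAxisymmetric`:
dihedrally symmetric minimal data for unboundedly many `k` yield a minimal blow-up datum that is
axisymmetric AND equivariant under the meridian reflection (closure of `⋃ D_{2^k} = O(2)`; the
mirror planes through the axis form a compact family). -/
def DihedralToReflAxisym : Prop :=
  ∀ ν : ℝ, 0 < ν →
    (∀ N : ℕ, ∃ k : ℕ, N ≤ k ∧ ∃ (u₀ : E3 → E3) (g : Hhalf),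
      IsMinimalBlowupDatum ν u₀ g ∧ IsDyadicDihedralSymmetric k u₀) →
    ∃ (u₀ : E3 → E3) (g : Hhalf), IsMinimalBlowupDatum ν u₀ g ∧ IsAxisymmetric u₀ ∧
      ∀ x : E3, u₀ (reflY x) = reflY (u₀ x)

/-- **The O(2)-symmetric minimal datum does not exist — a THEOREM of the tree.**  Axisymmetric +
reflection-equivariant ⇒ no swirl (`IsAxisymmetric.hasNoSwirl_of_reflY_eq`, Majda–Bertozzi §2.3.3)
⇒ global Kato solution for every `ν > 0` (`hasGlobalKatoSolution_of_isAxisymmetric_hasNoSwirl_viscosity`,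
the proved no-swirl stratum of the crux) ⇒ contradiction with minimality. -/
theorem no_reflAxisym_minimalDatum {ν : ℝ} (hν : 0 < ν) {u₀ : E3 → E3} {g : Hhalf}
    (hmin : IsMinimalBlowupDatum ν u₀ g) (hax : IsAxisymmetric u₀)
    (hrefl : ∀ x : E3, u₀ (reflY x) = reflY (u₀ x)) : False := by
  obtain ⟨hL3, -, hdiv, -, hnot⟩ := hmin
  exact hnot (hasGlobalKatoSolution_of_isAxisymmetric_hasNoSwirl_viscosity hν hL3 hdiv hax
    (hax.hasNoSwirl_of_reflY_eq hrefl))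

/-- **The dihedral bypass closes the summit without `AxisymmetricKatoGlobal`.** -/
theorem closes_dihedral (h₂ : MinimalDatumDihedral) (h₄ : DihedralToReflAxisym) :
    _root_.NavierStokesRegularity := by
  show Literature.NS.NavierStokesExistenceSmoothR3
  intro ν hν u₀ hsm hdiv hdec
  by_contra hno
  obtain ⟨u₁, g, hmin, hax, hrefl⟩ := h₄ ν hν (h₂ ν hν ⟨u₀, hsm, hdiv, hdec, hno⟩)
  exact no_reflAxisym_minimalDatum hν hmin hax hrefl

/-- Sanity link: the dihedral hypothesis block is the route's own (`ClayFailsAt` is verbatim the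
antecedent of `MinimalDatumPFold`). -/
theorem minimalDatumPFold_antecedent_iff (ν : ℝ) :
    ClayFailsAt ν ↔ (∃ v₀ : E3 → E3, ContDiff ℝ (⊤ : ℕ∞) v₀ ∧ NSWave0.IsDivFree v₀ ∧
      HasRapidSpatialDecay v₀ ∧ ¬ ∃ (u : ℝ → E3 → E3) (p : ℝ → E3 → ℝ), IsSmoothOnHalfSpace u ∧
        IsSmoothOnHalfSpace p ∧ IsNavierStokesSolution ν 0 v₀ u p ∧ HasBoundedEnergy u) :=
  Iff.rfl

/-! ## §2  Decomposition: rate-free evacuation (A) + absolute small-swirl criterion (B) -/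

/-- (A) `SwirlEvacuatesAxis`: along an axisymmetric Kato solution from `Ḣ^{1/2}`-represented data,
the swirl becomes uniformly SMALL at the axis up to the final time — for every `ε > 0` a radius
`δ > 0` with `|Γ| ≤ ε ν` on `{r ≤ δ} × [t₀, T)`.  No rate.  Weaker than stub 3
(`swirlEvacuatesAxis_of_swirlAxisModulus`); a consequence of AKG; open at `T = T_max`. -/
def SwirlEvacuatesAxis : Prop :=
  ∀ ν : ℝ, 0 < ν → ∀ T : ℝ, 0 < T → ∀ (u₀ : E3 → E3) (g : Hhalf) (u : ℝ → E3 → E3),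
    g.Represents (Literature.Analysis.FunctionSpaces.EuclideanSpace.complexify ∘ u₀) →
    IsKatoSolutionOn T ν u₀ u → ContDiffOn ℝ (⊤ : ℕ∞) (uncurry u) (Ioo 0 T ×ˢ univ) →
    (∀ t ∈ Ioo 0 T, IsAxisymmetric (u t)) →
    ∀ t₀ ∈ Ioo 0 T, ∀ ε : ℝ, 0 < ε → ∃ δ : ℝ, 0 < δ ∧
      ∀ t ∈ Ico t₀ T, ∀ x : E3, cylRadius x ≤ δ → |swirl (u t) x| ≤ ε * ν

/-- (B) `SmallSwirlBoundedNearTop`: an ABSOLUTE ε-small-swirl regularity criterion at axis points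
of axisymmetric Kato solutions — a universal `ε₀ > 0` such that `|Γ| ≤ ε₀ ν` on a slab
`{r ≤ δ} × [t₀, T)` forces boundedness near `(T, x₀)` for every axis point `x₀`.  No rate, no
relative smallness (print: Lei–Zhang 2017 Cor. 1.3 `C|ln r|⁻²`, Wei 2016 `|ln r|^{-3/2}`, Seregin
2022 `ln⁻³` local; Lei–Zhang Thm. 1.4 RELATIVE smallness `δ/M₀`).  The Kato-class, localised form of
the dormant route `SwirlThreshold`'s crux `SmallSwirlRegularity` (stmt-NavierStokesRegularity-2002). -/
def SmallSwirlBoundedNearTop : Prop :=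
  ∃ ε₀ : ℝ, 0 < ε₀ ∧ ∀ ν : ℝ, 0 < ν → ∀ T : ℝ, 0 < T → ∀ (u₀ : E3 → E3) (u : ℝ → E3 → E3),
    MemLp u₀ 3 volume → IsWeaklyDivFree u₀ → IsKatoSolutionOn T ν u₀ u →
    ContDiffOn ℝ (⊤ : ℕ∞) (uncurry u) (Ioo 0 T ×ˢ univ) → (∀ t ∈ Ioo 0 T, IsAxisymmetric (u t)) →
    ∀ x₀ : E3, cylRadius x₀ = 0 →
      (∃ t₀ ∈ Ioo 0 T, ∃ δ : ℝ, 0 < δ ∧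
        ∀ t ∈ Ico t₀ T, ∀ x : E3, cylRadius x ≤ δ → |swirl (u t) x| ≤ ε₀ * ν) →
      IsBoundedNearTop u T x₀

/-- **Assembly of the split, proved: A → B → AKG.**  By contradiction as in the registered line:
singular point of the maximal Kato solution (landed stub 1), boundedness near it — on the axis by
A + B, off the axis by the landed stubs K and 2b′ — contradicts the infinite `L^∞` norm. -/
theorem akg_of_evacuation_smallSwirl (hA : SwirlEvacuatesAxis) (hB : SmallSwirlBoundedNearTop) :
    AxisymmetricKatoGlobal := by
  obtain ⟨ε₀, hε₀, hB⟩ := hB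
  intro ν hν u₀ g hL3 hrep hdiv hax
  have hax' : IsAxisymmetric u₀ := fun θ x => hax θ x
  by_contra hng
  obtain ⟨T, hT, xs, u, hK, hsm, haxi, hsing⟩ :=
    stub_katoAxisymSingularPoint ν hν u₀ hL3 hdiv hax' hng
  have ht₀ : T / 2 ∈ Ioo 0 T := ⟨by linarith, by linarith⟩
  have hbdd : IsBoundedNearTop u T xs := by
    by_cases h0 : cylRadius xs = 0
    · obtain ⟨δ, hδ, hmod⟩ := hA ν hν T hT u₀ g u hrep hK hsm haxi (T / 2) ht₀ ε₀ hε₀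
      exact hB ν hν T hT u₀ u hL3 hdiv hK hsm haxi xs h0 ⟨T / 2, ht₀, δ, hδ, hmod⟩
    · obtain ⟨p, _hpax, hsw, hloc⟩ := stub_katoLocalEnergyNearTop ν hν T hT u₀ u hK hsm haxi
      exact stub_offAxisBounded_of_localEnergy ν hν T hT u p hsm haxi hsw hloc xs h0
  obtain ⟨r, hr, K, hbd⟩ := hbdd
  exact absurd (hsing r hr) (eLpNorm_parabolicCylinder_lt_top_of_forall_le hbd).ne

/-- **A is weaker than the registered stub 3** (`C/|log r|³ → 0` as `r → 0`). -/
theorem swirlEvacuatesAxis_of_swirlAxisModulus (h : SwirlAxisModulus) : SwirlEvacuatesAxis := by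
  intro ν hν T hT u₀ g u hrep hK hsm hax t₀ ht₀ ε hε
  obtain ⟨C, δ₀, hδ₀, _hδ₁, hmod⟩ := h ν hν T hT u₀ g u hrep hK hsm hax t₀ ht₀
  set L : ℝ := max 1 (|C| / (ε * ν)) with hL_def
  have hL1 : 1 ≤ L := le_max_left _ _
  have hLpos : 0 < L := lt_of_lt_of_le one_pos hL1
  have hεν : 0 < ε * ν := mul_pos hε hν
  refine ⟨min δ₀ (Real.exp (-L)), lt_min hδ₀ (Real.exp_pos _), ?_⟩
  intro t ht x hx
  have hxδ₀ : cylRadius x ≤ δ₀ := hx.trans (min_le_left _ _)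
  have hmain := hmod t ht x hxδ₀
  by_cases hr : cylRadius x = 0
  · rw [swirl_eq_zero_of_cylRadius_eq_zero _ hr, abs_zero]
    exact hεν.le
  · have hrpos : 0 < cylRadius x := lt_of_le_of_ne (cylRadius_nonneg x) (Ne.symm hr)
    have hrle : cylRadius x ≤ Real.exp (-L) := hx.trans (min_le_right _ _)
    have hlog : Real.log (cylRadius x) ≤ -L := by
      have h1 := Real.log_le_log hrpos hrle
      rwa [Real.log_exp] at h1
    have habs : L ≤ |Real.log (cylRadius x)| := by
      rw [abs_of_nonpos (by linarith)]
      linarith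
    have hpow : L ≤ |Real.log (cylRadius x)| ^ 3 := by
      calc L ≤ |Real.log (cylRadius x)| := habs
        _ = |Real.log (cylRadius x)| ^ 1 := (pow_one _).symm
        _ ≤ |Real.log (cylRadius x)| ^ 3 := pow_le_pow_right₀ (hL1.trans habs) (by norm_num)
    have hpowpos : 0 < |Real.log (cylRadius x)| ^ 3 := hLpos.trans_le hpow
    have hCL : |C| / (ε * ν) ≤ L := le_max_right _ _
    calc |swirl (u t) x| ≤ C / |Real.log (cylRadius x)| ^ 3 := hmain
      _ ≤ |C| / |Real.log (cylRadius x)| ^ 3 :=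
          div_le_div_of_nonneg_right (le_abs_self C) hpowpos.le
      _ ≤ |C| / L := div_le_div_of_nonneg_left (abs_nonneg C) hLpos hpow
      _ ≤ ε * ν := by
          rw [div_le_iff₀ hLpos]
          calc |C| = |C| / (ε * ν) * (ε * ν) := by field_simp
            _ ≤ L * (ε * ν) := by gcongr
            _ = ε * ν * L := by ring

/-! ## §3  Strengthen: a rigid (propagating) modulus -/

/-- (S⁺) `SwirlModulusPropagates`: the log³ axis modulus at ONE interior time propagates to the
final time with a doubled constant and the same radius — the shape a continuity / bootstrap
argument would prove.  Strictly stronger than stub 3 (`swirlAxisModulus_of_propagates`). -/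
def SwirlModulusPropagates : Prop :=
  ∀ ν : ℝ, 0 < ν → ∀ T : ℝ, 0 < T → ∀ (u₀ : E3 → E3) (g : Hhalf) (u : ℝ → E3 → E3),
    g.Represents (Literature.Analysis.FunctionSpaces.EuclideanSpace.complexify ∘ u₀) →
    IsKatoSolutionOn T ν u₀ u → ContDiffOn ℝ (⊤ : ℕ∞) (uncurry u) (Ioo 0 T ×ˢ univ) →
    (∀ t ∈ Ioo 0 T, IsAxisymmetric (u t)) →
    ∀ t₀ ∈ Ioo 0 T, ∀ C δ₀ : ℝ, 0 < δ₀ → δ₀ < 1 →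
      (∀ x : E3, cylRadius x ≤ δ₀ → |swirl (u t₀) x| ≤ C / |Real.log (cylRadius x)| ^ 3) →
      ∀ t ∈ Ico t₀ T, ∀ x : E3, cylRadius x ≤ δ₀ →
        |swirl (u t) x| ≤ 2 * C / |Real.log (cylRadius x)| ^ 3

/-- **S⁺ ⇒ stub 3** (the modulus at the single time `t₀ < T` is the trivial half
`swirlAxisModulus_of_lt`, applied on `[t₀, (t₀+T)/2) ⊂ [0, T)`). -/
theorem swirlAxisModulus_of_propagates (h : SwirlModulusPropagates) : SwirlAxisModulus := by
  intro ν hν T hT u₀ g u hrep hK hsm hax t₀ ht₀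
  have hmid : (t₀ + T) / 2 < T := by linarith [ht₀.2]
  have ht₀' : t₀ ∈ Ioo 0 ((t₀ + T) / 2) := ⟨ht₀.1, by linarith [ht₀.2]⟩
  obtain ⟨C, δ₀, hδ₀, hδ₁, hmod⟩ :=
    swirlAxisModulus_of_lt ν ((t₀ + T) / 2) T u₀ u hν hmid hK hsm.continuousOn t₀ ht₀'
  refine ⟨2 * C, δ₀, hδ₀, hδ₁, ?_⟩
  have h0 : ∀ x : E3, cylRadius x ≤ δ₀ → |swirl (u t₀) x| ≤ C / |Real.log (cylRadius x)| ^ 3 :=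
    fun x hx => hmod t₀ ⟨le_rfl, by linarith [ht₀.2]⟩ x hx
  exact h ν hν T hT u₀ g u hrep hK hsm hax t₀ ht₀ C δ₀ hδ₀ hδ₁ h0

/-! ## §4  Transfer: the first non-transferring step of the Type-I sibling -/

/-- `CriticalDriftNearAxis`: the hypothesis of KNSS 2009 Thm 5.3 / Chen–Strain–Tsai–Yau 2009
(`|u| ≤ C ν / r` near the axis) demanded A PRIORI up to the final time.  Under Type I it follows
from `|u| ≤ C/√(T−t)` and the parabolic geometry; under Type II (the only case left in the
axisymmetric class, Seregin 2020) nothing produces it — this is where the sibling's proof stops. -/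
def CriticalDriftNearAxis : Prop :=
  ∀ ν : ℝ, 0 < ν → ∀ T : ℝ, 0 < T → ∀ (u₀ : E3 → E3) (g : Hhalf) (u : ℝ → E3 → E3),
    g.Represents (Literature.Analysis.FunctionSpaces.EuclideanSpace.complexify ∘ u₀) →
    IsKatoSolutionOn T ν u₀ u → ContDiffOn ℝ (⊤ : ℕ∞) (uncurry u) (Ioo 0 T ×ˢ univ) →
    (∀ t ∈ Ioo 0 T, IsAxisymmetric (u t)) →
    ∀ t₀ ∈ Ioo 0 T, ∃ C δ₀ : ℝ, 0 < δ₀ ∧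
      ∀ t ∈ Ico t₀ T, ∀ x : E3, 0 < cylRadius x → cylRadius x ≤ δ₀ →
        ‖u t x‖ ≤ C * ν / cylRadius x

/-- The critical drift bound forces rate-free evacuation?  NO — it only gives `|Γ| ≤ r|u| ≤ Cν`,
a BOUNDED swirl Reynolds number, not a small one; the Hölder modulus of KNSS Thm 5.3 is a genuine
De Giorgi/Harnack theorem on top of it.  Recorded as the trivial consequence that does transfer. -/
theorem swirl_bounded_of_criticalDrift {u : ℝ → E3 → E3} {t : ℝ} {x : E3} {C ν : ℝ}
    (hr : 0 < cylRadius x) (h : ‖u t x‖ ≤ C * ν / cylRadius x) :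
    |swirl (u t) x| ≤ 2 * (C * ν) := by
  have h1 := abs_swirl_le_two_mul_cylRadius_mul_norm (u t) x
  calc |swirl (u t) x| ≤ 2 * cylRadius x * ‖u t x‖ := h1
    _ ≤ 2 * cylRadius x * (C * ν / cylRadius x) := by gcongr
    _ = 2 * (C * ν) := by field_simp

end Summit.NavierStokesRegularity.NavierStokesRegularity.Cruxes.AxisymmetricKatoGlobal.StrategistS12g10

end
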